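import Summits.CriticalPhenomena.PercolationContinuityZ3.Theorems.PercNearOneGluingNoHeavyLowerTailMajorityGluingTypeTableScaledStarB
import HarnessLib

/-!
# Template S in the kernel: the STAR cuts — the one-support tangent and the roots
(lane prim-rate, constants-miner 1, gen 30; KERNEL-WINDOW.md §1–§2 (tangent rows, brackets); RIGOROUS-CERTIFICATION.md §1)

Support file for the closed crux `NoHeavyLowerTail` (stmt-CriticalPhenomena-4575), majority-gluing line; continuation of
`…TypeTableScaledStar` / `…TypeTableScaledStarB` (`sqrt_star_scaled`, `starB_scaled`).  From the scaled STAR inequalities to the LP rows of template S: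

* `sqrt_star_root` — `T̂_z ≤ CuS(K,t)·Σ̂₄^{2p}` (`CuS = η^{16t}θ₄^{-2K-128}η^{K/2} ≥ θ^{-1/2}M_top^{κ₀/2}4^{-2p}`, grid monomials);
* `starB_root` — `T̂_z ≤ C_B·Σ̂₃^{e_B}` with `C_B = (2^{t})^{c₄β}(2+h)^{β}M_top^{(4−c₄)β}3^{−3β}`, `β = 1/(2c₄−1)`, `e_B = 3β`, and the
  certification `C_B ≤ CBU240 h t` of the table (four `rpow_le_cert` factors with continued-fraction exponent brackets);
* `cut1_sound` — the one-support rounded tangent.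

The exponent brackets, the certification of the table `CBU240` and the row theorems `star_valid` / `starB_valid` are in
`…TypeTableScaledStarConst`.

No percolation, no sorries.  [cite: VandenbergHaggstromKahn2005, Thm. 1.3 (p. 6)]
-/

namespace Summit.CriticalPhenomena.PercolationContinuityZ3.Theorems

namespace HubOnly
namespace TypeTable

open DType

noncomputable section

variable {K : ℕ} {M : ℝ} {x : DType → ℝ} {cs : SCase}

/-! ### One-support rounded tangent -/

/-- **The rounded tangent of a one-support power bound.**  `u ≤ C·s^q` (`0 ≤ q ≤ 1`, `0 ≤ C ≤ Cu`, `s ≥ 0`), support point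
`a = 2^{i/32}` with `a^q ≤ Pu`, exponent brackets `QL ≤ q ≤ QU`, and the rational checks `Cu·Pu·(1−QL) ≤ H/N`,
`Cu·QU·Pu·η^{-i} ≤ G/N` ⟹ `N·u − G·s ≤ H`. -/
theorem cut1_sound {u s C q : ℝ} {Cu Pu QL QU H : ℚ} {i : ℤ} {N G : ℕ} (hrow : u ≤ C * s ^ q) (hs : 0 ≤ s)
    (hq0 : 0 ≤ q) (hq1 : q ≤ 1) (hC0 : 0 ≤ C) (hC : C ≤ (Cu : ℝ))
    (hP : ((2 : ℝ) ^ ((i : ℝ) / 32)) ^ q ≤ (Pu : ℝ)) (hql : (QL : ℝ) ≤ q) (hqu : q ≤ (QU : ℝ)) (hN : 0 < N)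
    (c1 : Cu * Pu * (1 - QL) ≤ H / N) (c2 : Cu * QU * Pu * powUp ETAL ETAU (-i) ≤ (G : ℚ) / N) :
    (N : ℝ) * u + -(G : ℝ) * s ≤ H := by
  set a : ℝ := (2 : ℝ) ^ ((i : ℝ) / 32) with ha
  have ha0 : 0 < a := by positivity
  have htan := ConvexBootstrap.tangent_one hq0 hq1 ha0 hs
  have hP0 : 0 ≤ a ^ q := Real.rpow_nonneg ha0.le _
  have hCu0 : (0 : ℝ) ≤ Cu := hC0.trans hC
  -- u ≤ C a^q (1−q) + (C q a^q / a) s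
  have h1 : u ≤ C * a ^ q * (1 - q) + (C * q * a ^ q / a) * s := by
    have := mul_le_mul_of_nonneg_left htan hC0
    have e : C * (a ^ q * ((1 - q) + q * (s / a))) = C * a ^ q * (1 - q) + (C * q * a ^ q / a) * s := by
      field_simp
    linarith [hrow, this, e]
  have c1' : (Cu : ℝ) * Pu * (1 - QL) ≤ (H : ℝ) / N := by
    have h := (Rat.cast_le (K := ℝ)).mpr c1; push_cast at h; exact h
  have c2' : (Cu : ℝ) * QU * Pu * ((powUp ETAL ETAU (-i) : ℚ) : ℝ) ≤ (G : ℝ) / N := by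
    have h := (Rat.cast_le (K := ℝ)).mpr c2; push_cast at h; exact h
  have hh : C * a ^ q * (1 - q) ≤ (H : ℝ) / N := by
    have s1 : C * a ^ q ≤ Cu * Pu := RpowCert.mul_le_cert hC0 hC hP0 hP
    have s2 : C * a ^ q * (1 - q) ≤ Cu * Pu * (1 - q) := mul_le_mul_of_nonneg_right s1 (by linarith)
    have s3 : (Cu : ℝ) * Pu * (1 - q) ≤ Cu * Pu * (1 - QL) := mul_le_mul_of_nonneg_left (by linarith) (mul_nonneg hCu0 (hP0.trans hP))
    linarith
  have hg : C * q * a ^ q / a ≤ (G : ℝ) / N := (g_of_cert hC0 hC hP0 hP hq0 hqu ha0 (inv_supp_le i) c2')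
  have hN' : (0 : ℝ) < N := by exact_mod_cast hN
  have h2 : u ≤ H / N + (G : ℝ) / N * s := by nlinarith
  have := mul_le_mul_of_nonneg_left h2 hN'.le
  have e : (N : ℝ) * (H / N + (G : ℝ) / N * s) = H + G * s := by field_simp
  linarith

/-! ### sqrt-STAR: the root and the grid constant -/

/-- `K` even: `((K/2 : ℕ) : ℝ) = K/2`. -/
theorem half_cast {K : ℕ} (hK : K % 2 = 0) : ((K / 2 : ℕ) : ℝ) = (K : ℝ) / 2 := by
  have h : 2 * (K / 2) = K := Nat.two_mul_div_two_of_even (Nat.even_iff.mpr hK)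
  have : ((2 * (K / 2) : ℕ) : ℝ) = (K : ℝ) := by rw [h]
  push_cast at this
  linarith

/-- `((1/2)^t)^c)⁻¹ = 2^{t·c}`. -/
theorem half_pow_rpow_inv (t : ℕ) (c : ℝ) : ((((1 : ℝ) / 2) ^ t) ^ c)⁻¹ = (2 : ℝ) ^ ((t : ℝ) * c) := by
  have e : ((1 : ℝ) / 2) ^ t = (2 : ℝ) ^ (-(t : ℝ)) := by
    rw [Real.rpow_neg (by norm_num), Real.rpow_natCast, one_div, inv_pow]
  rw [e, ← Real.rpow_mul (by norm_num), ← Real.rpow_neg (by norm_num)]; congr 1; ring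

/-- `(1/2)^t = 2^{-t}` and `(2^{-t})⁻¹ = 2^t` as real powers. -/
theorem half_pow_inv (t : ℕ) : (((1 : ℝ) / 2) ^ t)⁻¹ = (2 : ℝ) ^ (t : ℝ) := by
  rw [one_div, inv_pow, inv_inv, Real.rpow_natCast]

/-- Three powers of two combine. -/
theorem two_rpow3 (a b d : ℝ) : (2 : ℝ) ^ a * (2 : ℝ) ^ b * (2 : ℝ) ^ d = (2 : ℝ) ^ (a + b + d) := by
  rw [Real.rpow_add (by norm_num), Real.rpow_add (by norm_num)]

/-- The sqrt-STAR constant is dominated by the grid monomial: `2^t · M_top^{(4−c₄)/c₄} · (4^{4/c₄})⁻¹ ≤ CuS(K,t)²` (`K` even). -/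
theorem CuS_sq_ge (hK : K % 2 = 0) (t : ℕ) :
    (2 : ℝ) ^ (t : ℝ) * Mtop K ^ ((4 - (3 + Real.sqrt (11 / 3)) / 2) * ((3 + Real.sqrt (11 / 3)) / 2)⁻¹) *
      ((4 : ℝ) ^ (4 * ((3 + Real.sqrt (11 / 3)) / 2)⁻¹))⁻¹ ≤ ((CuS K t : ℚ) : ℝ) ^ 2 := by
  set c := (3 + Real.sqrt (11 / 3)) / 2 with hc
  have hc0 : c ≠ 0 := ne_of_gt (lt_trans (by norm_num) ConvexBootstrap.two_lt_c4)
  -- the three grid factors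
  have g1 := grid_le ETAL_pos eta_bounds.1 eta_bounds.2 (16 * (t : ℤ))
  have g2 := grid_le (by decide +kernel) theta4_bounds.1 theta4_bounds.2 (-(2 * (K : ℤ)) - 128)
  have g3 := grid_le ETAL_pos eta_bounds.1 eta_bounds.2 ((K / 2 : ℕ) : ℤ)
  rw [← hc] at g2
  have p2 : (0 : ℝ) ≤ (2 : ℝ) ^ (c⁻¹ / 32 * ((-(2 * (K : ℤ)) - 128 : ℤ) : ℝ)) := by positivity
  have hP := mul_le_mul (mul_le_mul g1 g2 p2 (le_trans (by positivity) g1)) g3 (by positivity)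
    (mul_nonneg (le_trans (by positivity) g1) (le_trans p2 g2))
  have hP' : (2 : ℝ) ^ ((1 : ℝ) / 32 * ((16 * (t : ℤ) : ℤ) : ℝ)) * (2 : ℝ) ^ (c⁻¹ / 32 * ((-(2 * (K : ℤ)) - 128 : ℤ) : ℝ)) *
      (2 : ℝ) ^ ((1 : ℝ) / 32 * (((K / 2 : ℕ) : ℤ) : ℝ)) ≤ ((CuS K t : ℚ) : ℝ) := by
    refine hP.trans (le_of_eq ?_)
    simp only [CuS]; push_cast; ring
  have hA0 : (0 : ℝ) ≤ (2 : ℝ) ^ ((1 : ℝ) / 32 * ((16 * (t : ℤ) : ℤ) : ℝ)) * (2 : ℝ) ^ (c⁻¹ / 32 * ((-(2 * (K : ℤ)) - 128 : ℤ) : ℝ)) *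
      (2 : ℝ) ^ ((1 : ℝ) / 32 * (((K / 2 : ℕ) : ℤ) : ℝ)) := by positivity
  have hsq := pow_le_pow_left₀ hA0 hP' 2
  refine le_trans (le_of_eq ?_) hsq
  -- exponent bookkeeping: everything is a power of 2
  have h2 : (0 : ℝ) < 2 := by norm_num
  have eM : Mtop K ^ ((4 - c) * c⁻¹) = (2 : ℝ) ^ (-(K : ℝ) / 32 * ((4 - c) * c⁻¹)) := by
    simp only [Mtop]; rw [← Real.rpow_mul h2.le]
  have e4 : ((4 : ℝ) ^ (4 * c⁻¹))⁻¹ = (2 : ℝ) ^ (-(8 * c⁻¹)) := by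
    rw [show (4 : ℝ) = (2 : ℝ) ^ (2 : ℝ) by norm_num, ← Real.rpow_mul h2.le, ← Real.rpow_neg h2.le]; congr 1; ring
  rw [eM, e4, two_rpow3, two_rpow3, ← Real.rpow_natCast _ 2, ← Real.rpow_mul h2.le]
  congr 1
  have hcq : (4 - c) * c⁻¹ = 4 * c⁻¹ - 1 := by rw [sub_mul, mul_inv_cancel₀ hc0]
  have hk := half_cast hK
  rw [Int.cast_natCast (K / 2), hk, hcq]
  push_cast
  ring

/-- **The sqrt-STAR root**: `T̂_z ≤ CuS(K,t)·Σ̂₄^{2p}` for a non-dominant relay with an admissible code `t` (`K` even). -/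
theorem sqrt_star_root (L : SLaw K cs M x) (hK : K % 2 = 0) {z : ℕ} (hz : z ∈ [1, 2, 3, 4]) (hzw : z ≠ cs.w) {t : ℕ}
    (ht : tcodeLE (cs.bandOf z).tcode t = true) :
    Tm z (xs false K M cs.w x) ≤ ((CuS K t : ℚ) : ℝ) *
      (lin sig4φ (xs false K M cs.w x)) ^ (2 * ((3 + Real.sqrt (11 / 3)) / 2)⁻¹) := by
  set c := (3 + Real.sqrt (11 / 3)) / 2 with hc
  have hc2 : 2 < c := ConvexBootstrap.two_lt_c4
  have hcpos : 0 < c := by linarith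
  set q := c⁻¹ with hq
  have hq0 : 0 < q := inv_pos.mpr hcpos
  set T := Tm z (xs false K M cs.w x) with hT
  set S := lin sig4φ (xs false K M cs.w x) with hS
  obtain ⟨-, hLpos⟩ := L.scal_pos
  have hT0 : 0 ≤ T := by simp only [hT, Tm, lin_xs]; exact mul_nonneg hLpos.le (lin_ind_nonneg _ L.nonneg)
  have hS0 : 0 ≤ S := by rw [hS, lin_xs]; exact mul_nonneg hLpos.le (sig_nonneg L.nonneg L.wmem).1
  set θ : ℝ := ((1 : ℝ) / 2) ^ t with hθ
  have hθpos : 0 < θ := by positivity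
  have h1 := sqrt_star_scaled L hz hzw ht
  rw [← hT, ← hS, ← hθ, ← hc] at h1
  -- root of order c
  have h2 : θ * T ^ 2 ≤ (Mtop K ^ (4 - c) * (S / 4) ^ (4 : ℕ)) ^ q :=
    RpowCert.le_rpow_inv (mul_nonneg hθpos.le (sq_nonneg _)) hcpos h1
  have hM0 : 0 ≤ Mtop K ^ (4 - c) := Real.rpow_nonneg (Mtop_pos K).le _
  have hS4 : 0 ≤ S / 4 := by positivity
  have e1 : (Mtop K ^ (4 - c) * (S / 4) ^ (4 : ℕ)) ^ q = Mtop K ^ ((4 - c) * q) * ((S ^ (4 * q)) * ((4 : ℝ) ^ (4 * q))⁻¹) := by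
    rw [Real.mul_rpow hM0 (pow_nonneg hS4 _), ← Real.rpow_mul (Mtop_pos K).le, ← Real.rpow_natCast (S / 4),
      ← Real.rpow_mul hS4, Real.div_rpow hS0 (by norm_num)]
    push_cast; ring
  rw [e1] at h2
  -- T² ≤ CuS² S^{4q}
  have hcu := CuS_sq_ge hK t
  rw [← hc] at hcu
  have eθ : θ⁻¹ = (2 : ℝ) ^ (t : ℝ) := by rw [hθ]; exact half_pow_inv t
  have h3 : T ^ 2 ≤ (((CuS K t : ℚ) : ℝ)) ^ 2 * S ^ (4 * q) := by
    have hθinv : 0 < θ⁻¹ := inv_pos.mpr hθpos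
    have := mul_le_mul_of_nonneg_left h2 hθinv.le
    rw [← mul_assoc, inv_mul_cancel₀ (ne_of_gt hθpos), one_mul] at this
    refine this.trans ?_
    have hS4q : 0 ≤ S ^ (4 * q) := Real.rpow_nonneg hS0 _
    calc θ⁻¹ * (Mtop K ^ ((4 - c) * q) * (S ^ (4 * q) * ((4 : ℝ) ^ (4 * q))⁻¹))
        = ((2 : ℝ) ^ (t : ℝ) * Mtop K ^ ((4 - c) * q) * ((4 : ℝ) ^ (4 * q))⁻¹) * S ^ (4 * q) := by rw [eθ]; ring
      _ ≤ _ := mul_le_mul_of_nonneg_right hcu hS4q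
  have hC0 : (0 : ℝ) ≤ ((CuS K t : ℚ) : ℝ) := by exact_mod_cast (CuS_pos K t).le
  have e2 : (((CuS K t : ℚ) : ℝ)) ^ 2 * S ^ (4 * q) = ((((CuS K t : ℚ) : ℝ)) * S ^ (2 * q)) ^ 2 := by
    rw [mul_pow, ← Real.rpow_natCast (S ^ (2 * q)), ← Real.rpow_mul hS0]; push_cast; ring_nf
  rw [e2] at h3
  have h4 := Real.sqrt_le_sqrt h3
  rw [Real.sqrt_sq hT0, Real.sqrt_sq (mul_nonneg hC0 (Real.rpow_nonneg hS0 _))] at h4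
  exact h4

/-! ### STAR-B: the root -/

/-- **The STAR-B root**: `T̂_z ≤ C_B·Σ̂₃^{3β}`, `C_B = (θ^{−c₄}(2+h)M_top^{4−c₄})^{β}·(3^3)^{-β}·`… written as
`((θ^{c₄})⁻¹·(2+h)·M_top^{4−c₄})^{β} · ((1/3)^3)^{β}`, `β = 1/(2c₄−1)`. -/
theorem starB_root (L : SLaw K cs M x) {z : ℕ} (hz : z ∈ [1, 2, 3, 4]) (hzw : z ≠ cs.w) {h : ℚ}
    (hh : (cs.bandOf cs.w).hi = some h) {t : ℕ}
    (ht : tcodeLE (cs.bandOf z).tcode t = true ∨ tcodeLE (cs.bandOf cs.w).tcode t = true) :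
    Tm z (xs false K M cs.w x) ≤
      (((((1 : ℝ) / 2) ^ t) ^ ((3 + Real.sqrt (11 / 3)) / 2))⁻¹ * (2 + (h : ℝ)) * Mtop K ^ (4 - (3 + Real.sqrt (11 / 3)) / 2)) ^
          (2 * ((3 + Real.sqrt (11 / 3)) / 2) - 1)⁻¹ * ((1 : ℝ) / 3) ^ (3 * (2 * ((3 + Real.sqrt (11 / 3)) / 2) - 1)⁻¹) *
        (lin (sig3φ cs.w) (xs false K M cs.w x)) ^ (3 * (2 * ((3 + Real.sqrt (11 / 3)) / 2) - 1)⁻¹) := by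
  set c := (3 + Real.sqrt (11 / 3)) / 2 with hc
  have hc2 : 2 < c := ConvexBootstrap.two_lt_c4
  set d := 2 * c - 1 with hd
  have hdpos : 0 < d := by linarith
  set β := d⁻¹ with hβ
  have hβ0 : 0 ≤ β := (inv_pos.mpr hdpos).le
  set T := Tm z (xs false K M cs.w x) with hT
  set S := lin (sig3φ cs.w) (xs false K M cs.w x) with hS
  obtain ⟨-, hLpos⟩ := L.scal_pos
  have hT0 : 0 ≤ T := by simp only [hT, Tm, lin_xs]; exact mul_nonneg hLpos.le (lin_ind_nonneg _ L.nonneg)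
  have hS0 : 0 ≤ S := by rw [hS, lin_xs]; exact mul_nonneg hLpos.le (sig_nonneg L.nonneg L.wmem).2
  set θ : ℝ := ((1 : ℝ) / 2) ^ t with hθ
  have hθpos : 0 < θ := by positivity
  have hθc : 0 < θ ^ c := Real.rpow_pos_of_pos hθpos _
  have h1 := starB_scaled L hz hzw hh ht
  rw [← hT, ← hS, ← hθ, ← hc] at h1
  have h2h : 0 ≤ 2 + (h : ℝ) := by
    have hb := L.bandHi cs.w L.wmem h hh
    have hS' : 0 ≤ Sm cs.w x := lin_ind_nonneg _ L.nonneg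
    have hTw := L.Tpos cs.w L.wmem
    nlinarith
  have hM0 : 0 ≤ Mtop K ^ (4 - c) := Real.rpow_nonneg (Mtop_pos K).le _
  -- divide by θ^c
  have h2 : T ^ d ≤ ((θ ^ c)⁻¹ * (2 + (h : ℝ)) * Mtop K ^ (4 - c)) * (S / 3) ^ (3 : ℕ) := by
    have := mul_le_mul_of_nonneg_left h1 (inv_pos.mpr hθc).le
    rw [← mul_assoc, inv_mul_cancel₀ (ne_of_gt hθc), one_mul] at this
    refine this.trans (le_of_eq ?_); ring
  have hZ0 : 0 ≤ (θ ^ c)⁻¹ * (2 + (h : ℝ)) * Mtop K ^ (4 - c) := by positivity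
  have h3 := RpowCert.le_rpow_inv hT0 hdpos h2
  rw [Real.mul_rpow hZ0 (pow_nonneg (div_nonneg hS0 (by norm_num)) _), ← Real.rpow_natCast (S / 3),
    ← Real.rpow_mul (div_nonneg hS0 (by norm_num)), div_eq_mul_inv S 3,
    Real.mul_rpow hS0 (by norm_num : (0:ℝ) ≤ 3⁻¹)] at h3
  refine h3.trans (le_of_eq ?_)
  rw [show ((3 : ℝ)⁻¹) = 1 / 3 by norm_num]
  push_cast
  ring

end

end TypeTable
end HubOnly

end Summit.CriticalPhenomena.PercolationContinuityZ3.Theorems
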